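import Literature.Computability.Cryptography.ObfuscatedGluedTrees
import HarnessLib

/-!
# Toolkit stub `toolkit_nbrLabels` — the neighbour labels of a glued-trees vertex, on codes
# (crux `WbwObfuscatedGluedTrees`, stmt-QuantumAdvantage-2340; line `knowledge-of-walk-split`, stage 3, `NbrBitFP` piece G3)

The keyed glued-trees instance of `Literature/Computability/Cryptography/ObfuscatedGluedTrees.lean` names
the vertices `v = (side, depth j, position i)` of `G'_d` through their public labels
`label d v = side :: (bitsOf (d+1) j ++ bitsOf (d+1) i)` and glues the leaves along the cycle
`σ = cycleOf P μ k₃ k₄ d = (leafPerm P μ k₃ d, leafPerm P μ k₄ d)`, the two keyed Feistel permutations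
`prp` of `{0,1}^d` transported to `Fin 2^d` by `bitVecEquiv`.  This file proves that the map
`(1^μ, 1^d, k₃, k₄, label d v) ↦` the list of labels of the structural neighbours of `v` — the parent
(unless `v` is a root), then the two children (if `v` is not a leaf) or else the two cross neighbours
`cross₁ σ v`, `cross₂ σ v` — is computed on codes by a polynomial-time string function (`CodeFP`), GIVEN
the two permutation maps `w ↦ prp w`, `w ↦ prp⁻¹ w` on codes (hypotheses; the sibling stubs
`toolkit_prp`, `toolkit_prpSymm`).

The program (all in the typed calculus `CodeFP.lean` / `CodeFPArith.lean` / `CodeFPStrings.lean`): read the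
side bit and the two `(d+1)`-bit fields of the label as binary numerals (`strVal`); the parent is
`(side, j-1, i/2)`, the children `(side, j+1, 2i)`, `(side, j+1, 2i+1)` (`natSub`, `natDiv`, `natAdd`,
`natMul`), re-assembled with `bitsOf (d+1) n = fit (d+1) (bin n)` (`FPData.fitFP`); at a leaf (`j = d`,
position `ι < 2^d`) the cross neighbours sit on the other side at depth `d` and positions
`f (e⁻¹ ι)`, `f (e⁻¹ ι - 1)` (left leaf, `σ = (e, f)`) resp. `e (f⁻¹ ι)`, `e (f⁻¹ ι + 1)` (right leaf), where
on numerals `leafPerm κ = val (prp (bits κ))` (`nbrLab_val_leafPerm`: `bitVecEquiv` reads / writes binary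
digits) and `± 1` is taken modulo `2^d` (`natMod`, `natPow`).

## References

* [ChildsEtAl2003] A. M. Childs et al., *Exponential algorithmic speedup by a quantum walk*, STOC 2003, §2
  (the graphs `G'_n`: binary-heap coordinates, the alternating cycle).
* [AroraBarak2009] S. Arora, B. Barak, *Computational Complexity: A Modern Approach*, CUP 2009, §1.3
  (closure of polynomial time under composition).
-/

set_option linter.dupNamespace false

noncomputable section

namespace Summit.QuantumAdvantage.QuantumAdvantage.Theorems.WbwObfuscatedGluedTrees.KnowledgeOfWalk.Generator

open Literature.Computability.Cryptography Literature.Computability.Complexity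
open Literature.Computability.Cryptography.ObfuscatedGluedTrees Literature.Computability.QuantumComplexity
open Literature.Computability.Complexity.CodeFP
open GluedTrees

variable {d : ℕ}

/-! ### Binary digits: `bitsOf`, `bitsToNat`, numerals -/

/-- The digits listed by `bitsOf`. [folklore] -/
private theorem nbrLab_getD_bitsOf (w m : ℕ) (t : Fin w) : (bitsOf w m).getD t false = m.testBit t := by
  simp [bitsOf]

/-- `bitsOf w` is inverted by `bitsToNat` below `2^w`. [folklore] -/
private theorem nbrLab_bitsToNat_bitsOf {w m : ℕ} (h : m < 2 ^ w) : bitsToNat (bitsOf w m) = m := by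
  refine Nat.eq_of_testBit_eq fun t => ?_
  rw [Com.testBit_bitsToNat]
  by_cases ht : t < w
  · exact nbrLab_getD_bitsOf w m ⟨t, ht⟩
  · rw [List.getD_eq_default _ _ (by simpa using not_lt.1 ht),
      Nat.testBit_lt_two_pow (h.trans_le (Nat.pow_le_pow_right two_pos (not_lt.1 ht)))]

/-- The binary numeral of `m`, fitted to `w` bits, is `bitsOf w m`. [folklore] -/
private theorem nbrLab_fit_natE (w m : ℕ) : fit w (natE m) = bitsOf w m := by
  refine List.ext_getElem (by simp) fun t h₁ h₂ => ?_
  rw [length_bitsOf] at h₂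
  have hb : (bitsOf w m)[t]'(by simpa using h₂) = m.testBit t := by simp [bitsOf]
  rw [hb]
  simp only [fit, List.getElem_take, List.getElem_append]
  split_ifs with h
  · have := Com.testBit_bitsToNat (natE m) t
    rw [CodeFP.bitsToNat_natE, List.getD_eq_getElem _ _ h] at this
    exact this.symm
  · rw [List.getElem_replicate]
    exact (Nat.testBit_lt_two_pow (Nat.size_le.1 (by rw [← CodeFP.length_natE]; omega))).symm

/-! ### The leaf permutations on numerals -/

/-- The inverse bit-vector equivalence reads binary digits. [folklore] -/
private theorem nbrLab_bitVecEquiv_symm_apply (κ : Fin (2 ^ d)) :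
    (bitVecEquiv d).symm κ = fun t : Fin d => (κ : ℕ).testBit t := by
  funext t
  simp [bitVecEquiv, finTwoEquiv, Nat.testBit_eq_decide_div_mod_eq, Fin.ext_iff, Bool.beq_eq_decide_eq,
    finFunctionFinEquiv_symm_apply_val]

/-- The value of a bit vector under `bitVecEquiv` is `bitsToNat` of its list. [folklore] -/
private theorem nbrLab_val_bitVecEquiv (x : Fin d → Bool) :
    ((bitVecEquiv d x : Fin (2 ^ d)) : ℕ) = bitsToNat (List.ofFn x) := by
  have hlt : bitsToNat (List.ofFn x) < 2 ^ d := by simpa using bitsToNat_lt (List.ofFn x)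
  suffices h : bitVecEquiv d x = ⟨_, hlt⟩ by rw [h]
  rw [Equiv.apply_eq_iff_eq_symm_apply, nbrLab_bitVecEquiv_symm_apply]
  funext t
  simp [Com.testBit_bitsToNat, List.getD_eq_getElem?_getD]

/-- **The leaf permutation on numerals**: `e κ = val (prp (binary digits of κ))`. [folklore] -/
private theorem nbrLab_val_leafPerm (P : PuncturablePRFScheme) (μ : ℕ) (k : List Bool) (d : ℕ)
    (κ : Fin (2 ^ d)) : ((leafPerm P μ k d κ : Fin (2 ^ d)) : ℕ) =
      bitsToNat (List.ofFn (prp P μ k d fun t : Fin d => (κ : ℕ).testBit t)) := by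
  rw [leafPerm, Equiv.permCongr_apply, nbrLab_val_bitVecEquiv, nbrLab_bitVecEquiv_symm_apply]

/-- The inverse leaf permutation on numerals. [folklore] -/
private theorem nbrLab_val_leafPerm_symm (P : PuncturablePRFScheme) (μ : ℕ) (k : List Bool) (d : ℕ)
    (κ : Fin (2 ^ d)) : (((leafPerm P μ k d).symm κ : Fin (2 ^ d)) : ℕ) =
      bitsToNat (List.ofFn ((prp P μ k d).symm fun t : Fin d => (κ : ℕ).testBit t)) := by
  have : (leafPerm P μ k d).symm κ = bitVecEquiv d ((prp P μ k d).symm ((bitVecEquiv d).symm κ)) := by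
    rw [Equiv.symm_apply_eq, leafPerm, Equiv.permCongr_apply]; simp
  rw [this, nbrLab_val_bitVecEquiv, nbrLab_bitVecEquiv_symm_apply]

/-- Value of the successor along the cycle (`finRotate`). [folklore] -/
private theorem nbrLab_val_add_one (κ : Fin (2 ^ d)) : ((κ + 1 : Fin (2 ^ d)) : ℕ) = ((κ : ℕ) + 1) % 2 ^ d := by
  rw [Fin.val_add, Fin.val_one', Nat.add_mod_mod]

/-- Value of the predecessor along the cycle (`finRotate⁻¹`). [folklore] -/
private theorem nbrLab_val_sub_one (κ : Fin (2 ^ d)) : ((κ - 1 : Fin (2 ^ d)) : ℕ) = (2 ^ d - 1 + κ) % 2 ^ d := by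
  rw [Fin.val_sub, Fin.val_one']
  rcases Nat.eq_zero_or_pos d with rfl | hd
  · simp [Nat.mod_one]
  · rw [Nat.mod_eq_of_lt (Nat.one_lt_two_pow_iff.2 hd.ne')]

/-! ### Labels: fields, parent, children, leaves -/

/-- The three fields of a label: side bit, depth digits, position digits. [folklore] -/
private theorem nbrLab_label_fields (v : Vertex d) :
    (label d v).getD 0 false = v.1 ∧ ((label d v).drop 1).take (d + 1) = bitsOf (d + 1) (depth v) ∧
      (label d v).drop (d + 1 + 1) = bitsOf (d + 1) (idx v) := by
  refine ⟨rfl, ?_, ?_⟩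
  · simp [label, List.take_left', depth]
  · rw [label, List.drop_succ_cons, List.drop_left' (length_bitsOf _ _)]; rfl

/-- Label of a child (`j + 1`, `2i + b`). [folklore] -/
private theorem nbrLab_label_childV {v : Vertex d} (h : depth v < d) (b : Bool) :
    label d (childV v b) = v.1 :: (bitsOf (d + 1) (depth v + 1) ++ bitsOf (d + 1) (2 * idx v + b.toNat)) := by
  rw [childV, dif_pos h]; rfl

/-- Label of a left leaf. [folklore] -/
private theorem nbrLab_label_leafL (κ : Fin (2 ^ d)) :
    label d (leafL d κ) = false :: (bitsOf (d + 1) d ++ bitsOf (d + 1) κ) := rfl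

/-- Label of a right leaf. [folklore] -/
private theorem nbrLab_label_leafR (κ : Fin (2 ^ d)) :
    label d (leafR d κ) = true :: (bitsOf (d + 1) d ++ bitsOf (d + 1) κ) := rfl

/-! ### Typed polynomial time: digits, labels, permutation values -/

/-- `(1^w, n) ↦ bitsOf w n` (fit the binary numeral to `w` bits). [cite: AroraBarak2009, §1.3] -/
private theorem nbrLab_bitsOfFP : CodeFP (pairE unE natE) strE (fun p : ℕ × ℕ => bitsOf p.1 p.2) :=
  (FPData.fitFP.comp ((CodeFP.fst unE natE).pair (strOfNat.comp (CodeFP.snd unE natE)))).congr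
    fun p => nbrLab_fit_natE p.1 p.2

variable {α : Type} {eα : α → List Bool}

/-- Assembling a label `s :: (bitsOf (n+1) x ++ bitsOf (n+1) y)` from computed fields. [cite: AroraBarak2009, §1.3] -/
private theorem nbrLab_mkFP {g₁ : α → Bool} {g₂ g₃ g₄ : α → ℕ} (h₁ : CodeFP eα bitE g₁) (h₂ : CodeFP eα unE g₂)
    (h₃ : CodeFP eα natE g₃) (h₄ : CodeFP eα natE g₄) :
    CodeFP eα strE (fun a => g₁ a :: (bitsOf (g₂ a + 1) (g₃ a) ++ bitsOf (g₂ a + 1) (g₄ a))) :=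
  (consBit.comp (h₁.pair (strAppend.comp ((nbrLab_bitsOfFP.comp ((unSucc.comp h₂).pair h₃)).pair
    (nbrLab_bitsOfFP.comp ((unSucc.comp h₂).pair h₄)))))).congr fun _ => rfl

/-- A family of maps of `{0,1}^n` given on codes as strings, read on numerals:
`(1^μ, k, 1^n, m) ↦ val (F μ k n (binary digits of m))`. [cite: AroraBarak2009, §1.3] -/
private theorem nbrLab_valFP {F : ℕ → List Bool → (n : ℕ) → (Fin n → Bool) → Fin n → Bool}
    (hF : CodeFP (pairE unE (pairE strE (pairE unE strE))) strE
      (fun t : ℕ × List Bool × ℕ × List Bool => List.ofFn (F t.1 t.2.1 t.2.2.1 fun i => t.2.2.2.getD i false)))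
    {g₁ : α → ℕ} {g₂ : α → List Bool} {g₃ g₄ : α → ℕ} (h₁ : CodeFP eα unE g₁) (h₂ : CodeFP eα strE g₂)
    (h₃ : CodeFP eα unE g₃) (h₄ : CodeFP eα natE g₄) :
    CodeFP eα natE (fun a => bitsToNat (List.ofFn (F (g₁ a) (g₂ a) (g₃ a) fun i => (g₄ a).testBit i))) := by
  refine (strVal.comp (hF.comp (h₁.pair (h₂.pair (h₃.pair (nbrLab_bitsOfFP.comp (h₃.pair h₄))))))).congr
    fun a => ?_
  dsimp only
  simp only [nbrLab_getD_bitsOf]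

/-! ### The stub -/

/-- **TOOLKIT G3 — the neighbour LABELS of a vertex on codes.** Input `(1^μ, 1^d, k₃, k₄, label d v)`,
output the raw list of the labels of: the parent (unless `v` is a root), then the two children (if `v`
is not a leaf) or else the two cross neighbours `cross₁ σ v`, `cross₂ σ v` along the keyed cycle
`σ = cycleOf P μ k₃ k₄ d` — from the permutation maps `prp`, `prp⁻¹` on codes (hypotheses).
[cite: ChildsEtAl2003, §2] -/
theorem toolkit_nbrLabels :
    ∀ (P : PuncturablePRFScheme),
      Literature.Computability.Complexity.CodeFP (pairE unE (pairE strE strE)) strE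
        (fun p : ℕ × List Bool × List Bool => P.eval p.1 p.2.1 p.2.2) →
      Literature.Computability.Complexity.CodeFP (pairE unE (pairE strE (pairE unE strE))) strE
        (fun t : ℕ × List Bool × ℕ × List Bool =>
          List.ofFn ((prp P t.1 t.2.1 t.2.2.1) (fun i : Fin t.2.2.1 => t.2.2.2.getD (i : ℕ) false))) →
      Literature.Computability.Complexity.CodeFP (pairE unE (pairE strE (pairE unE strE))) strE
        (fun t : ℕ × List Bool × ℕ × List Bool =>
          List.ofFn ((prp P t.1 t.2.1 t.2.2.1).symm (fun i : Fin t.2.2.1 => t.2.2.2.getD (i : ℕ) false))) →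
      Literature.Computability.Complexity.CodeFP
        (fun t : ℕ × (Σ d : ℕ, List Bool × List Bool × GluedTrees.Vertex d) =>
          boolPair (unE t.1) (boolPair (unE t.2.1) (boolPair t.2.2.1 (boolPair t.2.2.2.1 (label t.2.1 t.2.2.2.2)))))
        (rawE strE)
        (fun t : ℕ × (Σ d : ℕ, List Bool × List Bool × GluedTrees.Vertex d) =>
          ((if GluedTrees.depth t.2.2.2.2 = 0 then [] else [GluedTrees.parentV t.2.2.2.2]) ++
            (if GluedTrees.depth t.2.2.2.2 < t.2.1 then
              [GluedTrees.childV t.2.2.2.2 false, GluedTrees.childV t.2.2.2.2 true]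
             else [GluedTrees.cross₁ (cycleOf P t.1 t.2.2.1 t.2.2.2.1 t.2.1) t.2.2.2.2,
                   GluedTrees.cross₂ (cycleOf P t.1 t.2.2.1 t.2.2.2.1 t.2.1) t.2.2.2.2])).map (label t.2.1)) := by
  intro P _ hA hB
  -- plain data `(μ, d, k₃, k₄, L)` under the input code
  let E : ℕ × ℕ × List Bool × List Bool × List Bool → List Bool :=
    pairE unE (pairE unE (pairE strE (pairE strE strE)))
  have hμ : CodeFP E unE fun a => a.1 := CodeFP.fst _ _
  have hd : CodeFP E unE fun a => a.2.1 := (CodeFP.snd _ _).fst'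
  have hk3 : CodeFP E strE fun a => a.2.2.1 := (CodeFP.snd _ _).snd'.fst'
  have hk4 : CodeFP E strE fun a => a.2.2.2.1 := (CodeFP.snd _ _).snd'.snd'.fst'
  have hL : CodeFP E strE fun a => a.2.2.2.2 := (CodeFP.snd _ _).snd'.snd'.snd'
  -- the fields of the label `L = s :: (J ++ I)`: side bit, depth and position as numerals
  have hs := strGetD.comp ((const E 0).pair hL)
  have hj := strVal.comp (strTake.comp ((unSucc.comp hd).pair (strDrop.comp ((const E 1).pair hL))))
  have hi := strVal.comp (strDrop.comp ((unSucc.comp (unSucc.comp hd)).pair hL))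
  -- the leaf arithmetic: keys by side, `κ = e⁻¹ ι` (resp. `f⁻¹ ι`), `κ ∓ 1 (mod 2^d)`, then `f` (resp. `e`)
  have hkA := hs.ite hk4 hk3
  have hkB := hs.ite hk3 hk4
  have hκ := nbrLab_valFP (F := fun μ k n => ⇑(prp P μ k n).symm) hB hμ hkA hd hi
  have hpow := natPow.comp ((const E 2).pair hd)
  have hrotR := natMod.comp ((natAdd.comp (hκ.pair (const E 1))).pair hpow)
  have hrotL := natMod.comp ((natAdd.comp ((natSub.comp (hpow.pair (const E 1))).pair hκ)).pair hpow)
  have hκ₂ := hs.ite hrotR hrotL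
  have hc₁ := nbrLab_valFP (F := fun μ k n => ⇑(prp P μ k n)) hA hμ hkB hd hκ
  have hc₂ := nbrLab_valFP (F := fun μ k n => ⇑(prp P μ k n)) hA hμ hkB hd hκ₂
  -- the five candidate labels: parent, two children, two cross neighbours
  have hP1 := nbrLab_mkFP hs hd (natSub.comp (hj.pair (const E 1))) (natDiv.comp (hi.pair (const E 2)))
  have hC0 := nbrLab_mkFP hs hd (natAdd.comp (hj.pair (const E 1))) (natMul.comp ((const E 2).pair hi))
  have hC1 := nbrLab_mkFP hs hd (natAdd.comp (hj.pair (const E 1)))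
    (natAdd.comp ((natMul.comp ((const E 2).pair hi)).pair (const E 1)))
  have hX1 := nbrLab_mkFP hs.not hd (natOfUn.comp hd) hc₁
  have hX2 := nbrLab_mkFP hs.not hd (natOfUn.comp hd) hc₂
  -- the list: `[parent | j ≠ 0] ++ (children | j < d, else crosses)`
  have h0 := natEq.comp (hj.pair (const E 0))
  have hlt := natLt.comp (hj.pair (natOfUn.comp hd))
  have hpart₁ := h0.ite (const E ([] : List (List Bool))) ((rawSingleton strE).comp hP1)
  have hpart₂ := hlt.ite ((rawCons strE).comp (hC0.pair ((rawSingleton strE).comp hC1)))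
    ((rawCons strE).comp (hX1.pair ((rawSingleton strE).comp hX2)))
  obtain ⟨f, hf, hfG⟩ := (rawAppend strE).comp (hpart₁.pair hpart₂)
  refine ⟨f, hf, fun t => ?_⟩
  obtain ⟨μ, d, k₃, k₄, v⟩ := t
  refine (hfG (μ, d, k₃, k₄, label d v)).trans ?_
  dsimp only
  obtain ⟨h1, h2, h3⟩ := nbrLab_label_fields v
  rw [h1, h2, h3, nbrLab_bitsToNat_bitsOf ((Nat.lt_succ_of_le (depth_le v)).trans Nat.lt_two_pow_self),
    nbrLab_bitsToNat_bitsOf ((idx_lt v).trans_le (Nat.pow_le_pow_right two_pos (Nat.le_succ_of_le (depth_le v))))]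
  simp only [id, decide_eq_true_eq, List.map_append]
  congr 1
  congr 1
  · -- the parent
    by_cases h0 : depth v = 0
    · simp [h0]
    · rw [if_neg h0, if_neg h0]; rfl
  · rcases Nat.lt_or_ge (depth v) d with hlt | hge
    · -- an inner vertex: the two children
      rw [if_pos hlt, if_pos hlt, List.map_cons, List.map_cons, List.map_nil, nbrLab_label_childV hlt,
        nbrLab_label_childV hlt]
      simp
    · -- a leaf: the two cross neighbours along the keyed cycle
      rw [if_neg (not_lt.2 hge), if_neg (not_lt.2 hge)]
      obtain ⟨ι, rfl | rfl⟩ := exists_eq_leaf (le_antisymm (depth_le v) hge)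
      · simp [cycleOf, crossR, nbrLab_label_leafR, nbrLab_val_leafPerm, nbrLab_val_leafPerm_symm,
          nbrLab_val_sub_one]
      · simp [cycleOf, crossL, nbrLab_label_leafL, nbrLab_val_leafPerm, nbrLab_val_leafPerm_symm,
          nbrLab_val_add_one]

end Summit.QuantumAdvantage.QuantumAdvantage.Theorems.WbwObfuscatedGluedTrees.KnowledgeOfWalk.Generator

end
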